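import Summits.QuantumFields.YangMills.Theorems.UnitScaleTiltProp7CovariantOffKernel
import HarnessLib

/-!
# Route `UnitScaleTilt`, crux K1 child «MinimiserStabilityRegPr» (stmt-QuantumFields-19200), route (α) GROWTH∕HESS_W — THE NON-FLAT LOCAL-MINIMALITY MODEL OFF THE KERNEL
# WITH THE COVARIANT DIVERGENCE DISPLAYED AS A PENALTY (twin of p1's `wilsonAction4_sub_background_ge_offKernel_T3`, p483802)

Cell `ym3-torus`, width seat `ym-ust-19200-w4` (gen 2; OWNER RULING (HESS_W) REVISED 2026-08-28 03:07:14Z (b): «the 15-line p483802 twin with the divergence penalty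
displayed», after ★w5-20520 g0 LOCATED 03:06:12Z (2): the ℓ²-optimal gauge's first-order condition is only `P_{su(2)} divB_W(Y_u) = 0`, with
`divB_W(Y_u) = −½(ΣY^*Y − ΣW^*Y^*YW)` quadratic — so `hdiv : D^*_{U₀}Y = 0` is never met exactly and the divergence must ride as a term).  THEOREMS ONLY (0 `def`, 0 `sorry`).
YM₃ on T³ is a ladder rung (R3), not the Clay problem; nothing here claims the stub, the crux, d = 4 or the mass gap.

WHAT.  `wilsonAction4_sub_background_ge_offKernel_divPen_T3`: p483802 VERBATIM with the binder `hdiv` REMOVED and the Hilbert–Schmidt divergence energy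
`(1/16)·Σ_x Σ_jk |(D^*_{U₀}Y)(x)_jk|²` SUBTRACTED on the left (p1's engine `sum_normSq_le_curl_sq_add_divB_sq_add_avg_T3` carries `18·Σ‖D^*Y‖²_HS`; through the `1/16` curl
slot of `quarter_hs_plaq_expansion_ge` it lands with coefficient `18/288 = 1/16`):
  `((1/288)L^{−2(K−n)} − 12(2a² + 128δ² + 8a))Σ_b‖Y(b)‖² − (1/18)(L^{3(K−n)}L^{2(K−n)})^{−1}L^{−2(K−n)}Σ_c‖A^{U₀}_cY‖² − (1/16)Σ_x‖(D^*_{U₀}Y)(x)‖²_HS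
   ≤ A(U) − A(U₀) − Lin_{U₀}(U)`,  `a = εL^{−2(K−n)}`, `Y = UU₀^* − 1`, `‖Y(b)‖ ≤ δ ≤ 1`, background in (14) with `216ε ≤ 1` — NO gauge and NO averaging hypothesis.
The proof is p1's, minus the `hdiv0` step.

HONEST SCOPE.  A re-assembly of p1's kernel theorems; MODEL caveats as in the parent files; nothing of Bałaban's is asserted; `--supports stmt-QuantumFields-19200`, count-neutral.

References: T. Bałaban, CMP 99 (1985) 389–434 [Balaban1985BackgroundPropagators] (Thm 3.11 p.416); CMP 102 (1985) 277–309 [Balaban1985Variational] ((14) p.280,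
(20)–(21) p.281, (141)–(143) p.299).
-/

noncomputable section

open scoped BigOperators Matrix.Norms.L2Operator Matrix

namespace Summit.QuantumFields.YangMills.Theorems.Prop7CovariantCoercivity

open Literature.MathematicalPhysics.QuantumFieldTheory.Balaban1983to89
open Finset B1RG242Torus
open B7Prop1Explicit (plaqWord U1 treeWord)
open B7Eq78Linearization (conjR)
open B9Eq39Adjoint (R R_def covD curl divB)
open B10StarCount (sum_pbond)
open B10Eq27TorusAxialLog (holT unitsField toUField unitsField_mem_unitaryUnits)
open B9TorusCalculus (torusT torusT_apply)
open Summit.QuantumFields.YangMills.Theorems.Prop7FlatLocalMin (sum_plaq_bonds_le)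

/-- **THE NON-FLAT LOCAL-MINIMALITY MODEL OFF THE KERNEL WITH THE DIVERGENCE AS A PENALTY, d = 3 CARRIER**: as `wilsonAction4_sub_background_ge_offKernel_T3` (background in
(14) with `216ε ≤ 1`, `Y = UU₀^* − 1` within `δ ≤ 1`) but WITHOUT the covariant Landau hypothesis — the divergence energy `(1/16)Σ_x‖(D^*_{U₀}Y)(x)‖²_HS` joins the averaging
penalty on the left; no gauge condition, no averaging condition. [cite: Balaban1985Variational, (141)-(143) p.299, (20)-(21) p.281; Balaban1985BackgroundPropagators, Thm 3.11 p.416] -/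
theorem wilsonAction4_sub_background_ge_offKernel_divPen_T3 (F : T3ContinuumYM3Torus.T3Family) (n K : ℕ)
    (U U₀ : GaugeField (F.P K) 0 (Matrix.specialUnitaryGroup (Fin 2) ℂ)) {ε δ : ℝ} (hε : 0 ≤ ε) (hε1 : 216 * ε ≤ 1)
    (hU₀ : ∀ p : Plaq (F.P K) 0, dist1 (GaugeField.plaqHol U₀ p) ≤ ε * (((F.L : ℝ) ^ (K - n)) ^ 2)⁻¹)
    (hδ : ∀ b : PBond (F.P K) 0, ‖(U b : Matrix (Fin 2) (Fin 2) ℂ) * star (U₀ b : Matrix (Fin 2) (Fin 2) ℂ) - 1‖ ≤ δ) (hδ1 : δ ≤ 1) :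
    ((1 / 288) * (((F.L : ℝ) ^ (K - n)) ^ 2)⁻¹
        - 12 * (2 * (ε * (((F.L : ℝ) ^ (K - n)) ^ 2)⁻¹) ^ 2 + 128 * δ ^ 2 + 8 * (ε * (((F.L : ℝ) ^ (K - n)) ^ 2)⁻¹)))
        * ∑ b : PBond (F.P K) 0, ‖(U b : Matrix (Fin 2) (Fin 2) ℂ) * star (U₀ b : Matrix (Fin 2) (Fin 2) ℂ) - 1‖ ^ 2
      - (1 / 18) * (((((F.L : ℝ) ^ (K - n)) ^ (F.P K).d) * ((F.L : ℝ) ^ (K - n)) ^ 2)⁻¹ * (((F.L : ℝ) ^ (K - n)) ^ 2)⁻¹)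
        * ∑ c : PBond (F.P K) (K - n), ‖∑ r : Fin (F.P K).d → Fin ((F.P K).L ^ (K - n)), ∑ t ∈ range ((F.P K).L ^ (K - n)),
        conjR (holT (unitsField (toUField U₀)) (Site.fibreSite 0 (K - n) c.src fun _ => ⟨0, pow_pos (F.P K).L_pos (K - n)⟩)
              (treeWord fun ν => ((r ν : ℕ) : ℤ))
            * holT (unitsField (toUField U₀)) (Site.fibreSite 0 (K - n) c.src r) (List.replicate t (c.dir, true)))
          ((U ⟨(fun z : Site (F.P K) 0 => z.shift c.dir)^[t] (Site.fibreSite 0 (K - n) c.src r), c.dir⟩ : Matrix (Fin 2) (Fin 2) ℂ)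
              * star (U₀ ⟨(fun z : Site (F.P K) 0 => z.shift c.dir)^[t] (Site.fibreSite 0 (K - n) c.src r), c.dir⟩ : Matrix (Fin 2) (Fin 2) ℂ) - 1)‖ ^ 2
      - (1 / 16) * ∑ x : Site (F.P K) 0, ∑ j : Fin 2, ∑ k : Fin 2,
          ‖(divB (torusT (F.P K) 0) (fun κ z => unitsField (toUField U₀) ⟨z, κ⟩)
              (fun κ z => (U ⟨z, κ⟩ : Matrix (Fin 2) (Fin 2) ℂ) * star (U₀ ⟨z, κ⟩ : Matrix (Fin 2) (Fin 2) ℂ) - 1) x) j k‖ ^ 2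
      ≤ wilsonAction4 U - wilsonAction4 U₀
        - ∑ p : Plaq (F.P K) 0, (1 / 2) * ((((((GaugeField.plaqHol U₀ p : Matrix.specialUnitaryGroup (Fin 2) ℂ) : Matrix (Fin 2) (Fin 2) ℂ)) - 1)ᴴ
          * ((((U ⟨p.src, p.μ⟩ : Matrix (Fin 2) (Fin 2) ℂ) * star (U₀ ⟨p.src, p.μ⟩ : Matrix (Fin 2) (Fin 2) ℂ) - 1)
              + (U₀ ⟨p.src, p.μ⟩ : Matrix (Fin 2) (Fin 2) ℂ)
                  * ((U ⟨p.src.shift p.μ, p.ν⟩ : Matrix (Fin 2) (Fin 2) ℂ) * star (U₀ ⟨p.src.shift p.μ, p.ν⟩ : Matrix (Fin 2) (Fin 2) ℂ) - 1)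
                  * star (U₀ ⟨p.src, p.μ⟩ : Matrix (Fin 2) (Fin 2) ℂ)
              - ((U₀ ⟨p.src, p.μ⟩ * U₀ ⟨p.src.shift p.μ, p.ν⟩ * (U₀ ⟨p.src.shift p.ν, p.μ⟩)⁻¹ : Matrix.specialUnitaryGroup (Fin 2) ℂ) : Matrix (Fin 2) (Fin 2) ℂ)
                  * ((U ⟨p.src.shift p.ν, p.μ⟩ : Matrix (Fin 2) (Fin 2) ℂ) * star (U₀ ⟨p.src.shift p.ν, p.μ⟩ : Matrix (Fin 2) (Fin 2) ℂ) - 1)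
                  * star ((U₀ ⟨p.src, p.μ⟩ * U₀ ⟨p.src.shift p.μ, p.ν⟩ * (U₀ ⟨p.src.shift p.ν, p.μ⟩)⁻¹ : Matrix.specialUnitaryGroup (Fin 2) ℂ) : Matrix (Fin 2) (Fin 2) ℂ)
              - ((GaugeField.plaqHol U₀ p : Matrix.specialUnitaryGroup (Fin 2) ℂ) : Matrix (Fin 2) (Fin 2) ℂ)
                  * ((U ⟨p.src, p.ν⟩ : Matrix (Fin 2) (Fin 2) ℂ) * star (U₀ ⟨p.src, p.ν⟩ : Matrix (Fin 2) (Fin 2) ℂ) - 1)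
                  * star ((GaugeField.plaqHol U₀ p : Matrix.specialUnitaryGroup (Fin 2) ℂ) : Matrix (Fin 2) (Fin 2) ℂ))
            * ((GaugeField.plaqHol U₀ p : Matrix.specialUnitaryGroup (Fin 2) ℂ) : Matrix (Fin 2) (Fin 2) ℂ))).trace).re := by
  set Y : PBond (F.P K) 0 → Matrix (Fin 2) (Fin 2) ℂ := fun b => (U b : Matrix (Fin 2) (Fin 2) ℂ) * star (U₀ b : Matrix (Fin 2) (Fin 2) ℂ) - 1 with hY
  set a : ℝ := ε * (((F.L : ℝ) ^ (K - n)) ^ 2)⁻¹ with ha_def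
  have hL0 : (0 : ℝ) < ((F.L : ℝ) ^ (K - n)) ^ 2 := by
    have : (0 : ℝ) < F.L := by have := F.hL.2; exact_mod_cast (by omega : 0 < F.L)
    positivity
  have ha : 0 ≤ a := mul_nonneg hε (inv_pos.mpr hL0).le
  -- (1) the per-plaquette expansion, summed
  have hper := fun p : Plaq (F.P K) 0 => quarter_hs_plaq_expansion_ge U U₀ p ha (hU₀ p) hδ hδ1
  have hsum := Finset.sum_le_sum fun p (_ : p ∈ (Finset.univ : Finset (Plaq (F.P K) 0))) => hper p
  rw [← wilsonAction4_eq_quarter_sum_hs U] at hsum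
  simp only [Finset.sum_sub_distrib, Finset.sum_add_distrib, ← Finset.mul_sum] at hsum
  have hA0 : (1 / 4 : ℝ) * ∑ p : Plaq (F.P K) 0, ∑ i₁ : Fin 2, ∑ i₂ : Fin 2,
      ‖((((GaugeField.plaqHol U₀ p : Matrix.specialUnitaryGroup (Fin 2) ℂ) : Matrix (Fin 2) (Fin 2) ℂ)) - 1) i₁ i₂‖ ^ 2 = wilsonAction4 U₀ := by
    rw [wilsonAction4_eq_quarter_sum_hs, Finset.mul_sum]
  rw [hA0] at hsum
  -- (2) the covariant curl form through Thm 3.11 at the small-field background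
  have hcurl : ∑ p : Plaq (F.P K) 0, ∑ i₁ : Fin 2, ∑ i₂ : Fin 2,
        ‖(((U ⟨p.src, p.μ⟩ : Matrix (Fin 2) (Fin 2) ℂ) * star (U₀ ⟨p.src, p.μ⟩ : Matrix (Fin 2) (Fin 2) ℂ) - 1)
            + (U₀ ⟨p.src, p.μ⟩ : Matrix (Fin 2) (Fin 2) ℂ)
                * ((U ⟨p.src.shift p.μ, p.ν⟩ : Matrix (Fin 2) (Fin 2) ℂ) * star (U₀ ⟨p.src.shift p.μ, p.ν⟩ : Matrix (Fin 2) (Fin 2) ℂ) - 1)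
                * star (U₀ ⟨p.src, p.μ⟩ : Matrix (Fin 2) (Fin 2) ℂ)
            - (U₀ ⟨p.src, p.ν⟩ : Matrix (Fin 2) (Fin 2) ℂ)
                * ((U ⟨p.src.shift p.ν, p.μ⟩ : Matrix (Fin 2) (Fin 2) ℂ) * star (U₀ ⟨p.src.shift p.ν, p.μ⟩ : Matrix (Fin 2) (Fin 2) ℂ) - 1)
                * star (U₀ ⟨p.src, p.ν⟩ : Matrix (Fin 2) (Fin 2) ℂ)
            - ((U ⟨p.src, p.ν⟩ : Matrix (Fin 2) (Fin 2) ℂ) * star (U₀ ⟨p.src, p.ν⟩ : Matrix (Fin 2) (Fin 2) ℂ) - 1)) i₁ i₂‖ ^ 2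
      = ∑ x : Site (F.P K) 0, ∑ μ : Fin (F.P K).d, ∑ ν : Fin (F.P K).d,
          (if μ < ν then ∑ i₁ : Fin 2, ∑ i₂ : Fin 2,
            ‖(B9Eq39Adjoint.curl (torusT (F.P K) 0) (fun κ z => unitsField (toUField U₀) ⟨z, κ⟩) (fun κ z => Y ⟨z, κ⟩) μ ν x) i₁ i₂‖ ^ 2 else 0) := by
    rw [← sum_plaq_eq_sum_ite (fun x μ ν => ∑ i₁ : Fin 2, ∑ i₂ : Fin 2,
      ‖(B9Eq39Adjoint.curl (torusT (F.P K) 0) (fun κ z => unitsField (toUField U₀) ⟨z, κ⟩) (fun κ z => Y ⟨z, κ⟩) μ ν x) i₁ i₂‖ ^ 2)]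
    refine Finset.sum_congr rfl fun p _ => ?_
    rw [curl_bg_eq U₀ Y p]
  have h311 := sum_normSq_le_curl_sq_add_divB_sq_add_avg_T3 F n K U₀ hε hε1 hU₀ Y
  rw [← hcurl] at h311
  -- (3) the error terms through the bond–plaquette incidence
  have hinc := sum_plaq_bonds_le (P := F.P K) (j := 0) (fun b => ‖Y b‖ ^ 2) (fun b => sq_nonneg _)
  have hd : ((F.P K).d : ℝ) = 3 := by norm_num [T3ContinuumYM3Torus.T3Family.P_d]
  rw [hd] at hinc
  have hc0 : 0 ≤ 2 * a ^ 2 + 128 * δ ^ 2 + 8 * a := by positivity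
  have herr := mul_le_mul_of_nonneg_left hinc hc0
  simp only [Finset.sum_add_distrib] at herr
  -- assemble
  simp only [hY] at h311 herr hsum
  rw [← Finset.mul_sum]
  linarith [hsum, h311, herr]


end Summit.QuantumFields.YangMills.Theorems.Prop7CovariantCoercivity

end
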